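import Summits.SmoothPoincare4.SmoothPoincare4.Theses.SymplecticOrigami

/-!
# Stub `stub_sides` of line `pair-rigidity-endgame` (crux `SymplecticOrigami.OrigamiRung`)

On a connected `4`-manifold `M`, let `V 0, V 1` be disjoint non-empty open sets whose common
complement is connected and is the image of a smooth embedding `z : Z → M` of a `3`-manifold.
Then both pieces have frontier exactly `range z` and are regular-open
(`interior (closure (V i)) = V i`).

The proof is elementary point-set topology on top of Mathlib's slice-chart definition of
immersions (`Manifold.IsImmersionAt`: in suitable charts `z` reads `u ↦ equiv (u, 0)`):

* `exists_local_sides` — at each point of the hypersurface there is an open box `O` of `M` whose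
  part off `range z` is covered by two preconnected sets (the two open half-boxes of a slice
  chart, shrunk using the topological-embedding half of `IsSmoothEmbedding` so that no other sheet
  of `range z` enters), each having every point of `range z ∩ O` in its closure;
* `subset_closure_of_local_sides` — hence the set of points of `range z` adherent to `V 1` is open
  and closed in the connected `range z`; it is non-empty since otherwise `V 1` would be clopen,
  non-empty and proper in the connected `M`; so `range z ⊆ closure (V 1)` (and symmetrically
  `⊆ closure (V 0)`);
* `frontier_eq_and_interior_closure_eq` — the two adherences give `frontier (V i) = range z` and
  `interior (closure (V i)) = V i`.
-/

noncomputable section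

-- the prescribed namespace `Summit.<P>.<Sub>.…` duplicates `SmoothPoincare4` (P = Sub)
set_option linter.dupNamespace false

open scoped Manifold ContDiff Topology ContinuousMap
open Set TopologicalSpace
open Literature.Topology.FourManifolds (singularHomologyZ sphereInversion IsTwistedSphere)
open Literature.Geometry.Kaehler (MForm IsSmoothForm IsClosedForm)

namespace Summit.SmoothPoincare4.SmoothPoincare4.Theorems.OrigamiRung.PairRigidityEndgame

/-- Model space `ℝⁿ`. -/
local notation "𝔼" n:arg => EuclideanSpace ℝ (Fin n)
/-- The round 4-sphere. -/
local notation "𝕊⁴" => (Metric.sphere (0 : EuclideanSpace ℝ (Fin 5)) 1)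
/-- The round 2-sphere. -/
local notation "𝕊²" => (Metric.sphere (0 : EuclideanSpace ℝ (Fin 3)) 1)
/-- The closed unit 4-ball with its manifold-with-boundary structure (`ClosedBall.lean`). -/
local notation "𝔻⁴" => (Metric.closedBall (0 : EuclideanSpace ℝ (Fin (3 + 1))) 1)

/-! ### The two local sides of a smoothly embedded hypersurface -/

section LocalSides

variable {n : ℕ} {S : Type*} [TopologicalSpace S] [ChartedSpace (𝔼 n) S]
  {X : Type*} [TopologicalSpace X] [ChartedSpace (𝔼 (n + 1)) X] {f : S → X}

/-- **The two local sides of a smoothly embedded hypersurface.**  Let `f : S → X` be a smooth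
embedding of an `n`-manifold into an `(n+1)`-manifold (models `𝓡 n`, `𝓡 (n+1)`) and `z₀ ∈ S`.
There are an open neighbourhood `O` of `f z₀` and two preconnected subsets `H₁, H₂` of the
complement of `range f` such that `O ⊆ range f ∪ H₁ ∪ H₂` and every point of `range f ∩ O` lies
in the closure of `H₁` and of `H₂`.  (In the slice charts `φ, ψ` of Mathlib's immersion data at
`z₀`, straightened by an identification of the one-dimensional complement with `ℝ`, `f` reads
`u ↦ (u, 0)`; `O` is the pull-back of a small ball around `(φ z₀, 0)` — small enough that, `f`
being a topological embedding, `range f ∩ O` is exactly the slice `{last coordinate = 0}` — and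
`H₁, H₂` are the images of its two convex open halves.)
[cite: LeeSmoothManifolds2013, Thm. 5.8 and Prop. 5.2] -/
theorem exists_local_sides (hf : Manifold.IsSmoothEmbedding (𝓡 n) (𝓡 (n + 1)) ∞ f) (z₀ : S) :
    ∃ O H₁ H₂ : Set X, IsOpen O ∧ f z₀ ∈ O ∧ IsPreconnected H₁ ∧ IsPreconnected H₂ ∧
      H₁ ⊆ (range f)ᶜ ∧ H₂ ⊆ (range f)ᶜ ∧ O ⊆ range f ∪ (H₁ ∪ H₂) ∧
      range f ∩ O ⊆ closure H₁ ∧ range f ∩ O ⊆ closure H₂ := by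
  have hi : Manifold.IsImmersionAt (𝓡 n) (𝓡 (n + 1)) ∞ f z₀ := hf.isImmersion.isImmersionAt z₀
  -- the complement in the immersion data is a line; straighten `ℝⁿ⁺¹ ≃ ℝⁿ × ℝ`
  haveI : FiniteDimensional ℝ hi.complement := by
    haveI : Module.Finite ℝ ((𝔼 n) × hi.complement) :=
      Module.Finite.equiv hi.equiv.toLinearEquiv.symm
    exact Module.Finite.of_injective (LinearMap.inr ℝ (𝔼 n) hi.complement) LinearMap.inr_injective
  have hrank : Module.finrank ℝ hi.complement = Module.finrank ℝ ℝ := by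
    have h := hi.equiv.toLinearEquiv.finrank_eq
    rw [Module.finrank_prod, finrank_euclideanSpace_fin, finrank_euclideanSpace_fin] at h
    rw [Module.finrank_self]
    omega
  obtain ⟨T, hT⟩ : ∃ T : (𝔼 (n + 1)) ≃L[ℝ] (𝔼 n) × ℝ, ∀ a : 𝔼 n, T (hi.equiv (a, 0)) = (a, 0) := by
    refine ⟨hi.equiv.symm.trans ((ContinuousLinearEquiv.refl ℝ (𝔼 n)).prodCongr
      (ContinuousLinearEquiv.ofFinrankEq hrank)), fun a => ?_⟩
    simp
  -- in the charts `φ = hi.domChart`, `ψ = hi.codChart`, `f` reads `z ↦ T.symm (φ z, 0)`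
  have hTf : ∀ z ∈ hi.domChart.source, T (hi.codChart (f z)) = (hi.domChart z, 0) := by
    intro z hz
    have hmem : (hi.domChart.extend (𝓡 n)) z ∈ (hi.domChart.extend (𝓡 n)).target :=
      (hi.domChart.extend (𝓡 n)).map_source
        (by rw [OpenPartialHomeomorph.extend_source]; exact hz)
    have hw := hi.writtenInCharts hmem
    simp only [Function.comp_apply] at hw
    rw [OpenPartialHomeomorph.extend_left_inv _ hz] at hw
    have h1 : (hi.codChart.extend (𝓡 (n + 1))) (f z) = hi.codChart (f z) := by
      rw [OpenPartialHomeomorph.extend_coe, Function.comp_apply, modelWithCornersSelf_coe, id]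
    have h2 : (hi.domChart.extend (𝓡 n)) z = hi.domChart z := by
      rw [OpenPartialHomeomorph.extend_coe, Function.comp_apply, modelWithCornersSelf_coe, id]
    rw [h1, h2] at hw
    rw [hw, hT]
  -- an open set of `X` cutting out the source of the domain chart (`f` is an embedding)
  obtain ⟨Wo, hWo, hWo_pre⟩ := hf.isEmbedding.isInducing.isOpen_iff.mp hi.domChart.open_source
  have hz₀φ : z₀ ∈ hi.domChart.source := hi.mem_domChart_source
  have hpψ : f z₀ ∈ hi.codChart.source := hi.mem_codChart_source
  -- the admissible region in straightened coordinates, and a ball inside it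
  set G : Set ((𝔼 n) × ℝ) := T.symm ⁻¹' (hi.codChart.target ∩ hi.codChart.symm ⁻¹' Wo) ∩
    Prod.fst ⁻¹' hi.domChart.target with hG
  have hGo : IsOpen G :=
    ((hi.codChart.isOpen_inter_preimage_symm hWo).preimage T.symm.continuous).inter
      (hi.domChart.open_target.preimage continuous_fst)
  have hG₀ : (hi.domChart z₀, (0 : ℝ)) ∈ G := by
    refine ⟨?_, hi.domChart.map_source hz₀φ⟩
    show T.symm (hi.domChart z₀, 0) ∈ hi.codChart.target ∩ hi.codChart.symm ⁻¹' Wo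
    rw [← hTf z₀ hz₀φ, ContinuousLinearEquiv.symm_apply_apply]
    refine ⟨hi.codChart.map_source hpψ, ?_⟩
    rw [mem_preimage, hi.codChart.left_inv hpψ, ← mem_preimage, hWo_pre]
    exact hz₀φ
  obtain ⟨r, hr, hball⟩ := Metric.isOpen_iff.mp hGo _ hG₀
  set Bx : Set ((𝔼 n) × ℝ) := Metric.ball (hi.domChart z₀, (0 : ℝ)) r with hBx
  have hBxo : IsOpen Bx := Metric.isOpen_ball
  have hBxt : ∀ q ∈ Bx, T.symm q ∈ hi.codChart.target := fun q hq => (hball hq).1.1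
  -- the pull-back `g = ψ⁻¹ ∘ T⁻¹`, continuous on the ball
  set g : (𝔼 n) × ℝ → X := fun q => hi.codChart.symm (T.symm q) with hg
  have hgc : ContinuousOn g Bx :=
    hi.codChart.continuousOn_symm.comp T.symm.continuous.continuousOn hBxt
  -- the box `O`
  set O : Set X := {x | x ∈ hi.codChart.source ∧ T (hi.codChart x) ∈ Bx} with hO
  have hOo : IsOpen O :=
    (T.continuous.comp_continuousOn hi.codChart.continuousOn).isOpen_inter_preimage
      hi.codChart.open_source hBxo
  have hOWo : O ⊆ Wo := by
    rintro x ⟨hx, hxB⟩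
    have h1 := (hball hxB).1.2
    simp only [mem_preimage, ContinuousLinearEquiv.symm_apply_apply] at h1
    rwa [hi.codChart.left_inv hx] at h1
  have hgx : ∀ x ∈ O, g (T (hi.codChart x)) = x := fun x hx => by
    simp only [hg, ContinuousLinearEquiv.symm_apply_apply, hi.codChart.left_inv hx.1]
  have hTg : ∀ q ∈ Bx, T (hi.codChart (g q)) = q := fun q hq => by
    simp only [hg, hi.codChart.right_inv (hBxt q hq), ContinuousLinearEquiv.apply_symm_apply]
  have hgO : ∀ q ∈ Bx, g q ∈ O := fun q hq =>
    ⟨hi.codChart.map_target (hBxt q hq), by rw [hTg q hq]; exact hq⟩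
  -- inside the box, `range f` is exactly the slice `{q.2 = 0}`
  have hslice : ∀ q ∈ Bx, g q ∈ range f → q.2 = 0 := by
    rintro q hq ⟨z, hz⟩
    have hzφ : z ∈ hi.domChart.source := by
      rw [← hWo_pre]
      exact hOWo (hz ▸ hgO q hq)
    have h := hTf z hzφ
    rw [hz, hTg q hq] at h
    rw [h]
  have hslice' : ∀ x ∈ O, (T (hi.codChart x)).2 = 0 → x ∈ range f := by
    intro x hx h0
    have ha : (T (hi.codChart x)).1 ∈ hi.domChart.target := (hball hx.2).2
    have hzs : hi.domChart.symm (T (hi.codChart x)).1 ∈ hi.domChart.source :=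
      hi.domChart.map_target ha
    refine ⟨hi.domChart.symm (T (hi.codChart x)).1, ?_⟩
    have hfz : f (hi.domChart.symm (T (hi.codChart x)).1) ∈ hi.codChart.source :=
      hi.source_subset_preimage_source hzs
    have hTz :
        T (hi.codChart (f (hi.domChart.symm (T (hi.codChart x)).1))) = T (hi.codChart x) := by
      rw [hTf _ hzs, hi.domChart.right_inv ha]
      exact Prod.ext rfl h0.symm
    exact hi.codChart.injOn hfz hx.1 (T.injective hTz)
  -- the half-boxes over a convex `s ⊆ ℝ` missing `0` but adherent to it
  have key : ∀ s : Set ℝ, Convex ℝ s → (0 : ℝ) ∉ s → (0 : ℝ) ∈ closure s →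
      IsPreconnected (g '' (Bx ∩ Prod.snd ⁻¹' s)) ∧ g '' (Bx ∩ Prod.snd ⁻¹' s) ⊆ (range f)ᶜ ∧
        range f ∩ O ⊆ closure (g '' (Bx ∩ Prod.snd ⁻¹' s)) := by
    intro s hs h0 h0c
    refine ⟨?_, ?_, ?_⟩
    · exact ((convex_ball _ _).inter
        (hs.linear_preimage (LinearMap.snd ℝ (𝔼 n) ℝ))).isPreconnected.image _
          (hgc.mono inter_subset_left)
    · rintro _ ⟨q, ⟨hqB, hqs⟩, rfl⟩ hmem
      exact h0 (hslice q hqB hmem ▸ hqs)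
    · rintro x ⟨hxr, hxO⟩
      have hq0 : (T (hi.codChart x)).2 = 0 := hslice _ hxO.2 ((hgx x hxO).symm ▸ hxr)
      have hqc : T (hi.codChart x) ∈ closure (Bx ∩ Prod.snd ⁻¹' s) := by
        refine hBxo.inter_closure ⟨hxO.2, ?_⟩
        refine isOpenMap_snd.preimage_closure_subset_closure_preimage ?_
        rw [mem_preimage, hq0]
        exact h0c
      rw [← hgx x hxO]
      exact ((hgc.continuousWithinAt hxO.2).mono inter_subset_left).mem_closure_image hqc
  obtain ⟨hc₁, hr₁, hcl₁⟩ := key (Ioi 0) (convex_Ioi 0) (fun h => lt_irrefl (0 : ℝ) h)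
    (by rw [closure_Ioi]; exact mem_Ici.2 le_rfl)
  obtain ⟨hc₂, hr₂, hcl₂⟩ := key (Iio 0) (convex_Iio 0) (fun h => lt_irrefl (0 : ℝ) h)
    (by rw [closure_Iio]; exact mem_Iic.2 le_rfl)
  refine ⟨O, _, _, hOo, ⟨hpψ, by rw [hTf z₀ hz₀φ]; exact Metric.mem_ball_self hr⟩, hc₁, hc₂,
    hr₁, hr₂, fun x hx => ?_, hcl₁, hcl₂⟩
  -- `O ⊆ range f ∪ (H₁ ∪ H₂)`
  by_cases hxr : x ∈ range f
  · exact Or.inl hxr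
  have hne : (T (hi.codChart x)).2 ≠ 0 := fun h => hxr (hslice' x hx h)
  rcases hne.lt_or_gt with hneg | hpos
  · exact Or.inr (Or.inr ⟨T (hi.codChart x), ⟨hx.2, hneg⟩, hgx x hx⟩)
  · exact Or.inr (Or.inl ⟨T (hi.codChart x), ⟨hx.2, hpos⟩, hgx x hx⟩)

end LocalSides

/-! ### Point-set topology of a two-sided splitting -/

section Splitting

variable {X : Type*} [TopologicalSpace X]

/-- **Adherence of both pieces along a locally two-sided splitting hypersurface.**  Let `X` be
connected, `U, W ⊆ X` open, disjoint and non-empty, and `K = (U ∪ W)ᶜ` preconnected, such that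
every point of `K` has an open neighbourhood `O` with `O ∖ K` covered by two preconnected
subsets of `Kᶜ` each having all of `K ∩ O` in its closure.  Then `K ⊆ closure W`.  (The set of
points of `K` adherent to `W` is closed, and open in `K` by the local picture — a preconnected
set off `K` meeting `W` lies in `W`; it is non-empty, for otherwise `W` would be closed, hence
clopen, non-empty and proper in the connected `X`; so it is all of the preconnected `K`.)
[folklore] -/
theorem subset_closure_of_local_sides [ConnectedSpace X] {U W K : Set X} (hU : IsOpen U)
    (hW : IsOpen W) (hUW : Disjoint U W) (hUne : U.Nonempty) (hWne : W.Nonempty)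
    (hK : K = (U ∪ W)ᶜ) (hKc : IsPreconnected K)
    (hloc : ∀ x ∈ K, ∃ O H₁ H₂ : Set X, IsOpen O ∧ x ∈ O ∧ IsPreconnected H₁ ∧
      IsPreconnected H₂ ∧ H₁ ⊆ Kᶜ ∧ H₂ ⊆ Kᶜ ∧ O ⊆ K ∪ (H₁ ∪ H₂) ∧
      K ∩ O ⊆ closure H₁ ∧ K ∩ O ⊆ closure H₂) :
    K ⊆ closure W := by
  have hKc' : Kᶜ = U ∪ W := by rw [hK, compl_compl]
  -- a preconnected subset of `Kᶜ` meeting `W` lies in `W`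
  have absorb : ∀ {H : Set X} {y : X}, IsPreconnected H → H ⊆ Kᶜ → y ∈ H → y ∈ W → H ⊆ W := by
    intro H y hH hHK hyH hyW
    rcases hH.subset_or_subset hU hW hUW (hKc' ▸ hHK) with h | h
    · exact absurd (h hyH) (hUW.symm.notMem_of_mem_left hyW)
    · exact h
  -- the set of points of `K` adherent to `W` is open in `K`
  have hopen : ∀ x ∈ K, x ∈ closure W → ∃ O : Set X, IsOpen O ∧ x ∈ O ∧ K ∩ O ⊆ closure W := by
    intro x hxK hxW
    obtain ⟨O, H₁, H₂, hOo, hxO, hH₁, hH₂, hH₁K, hH₂K, hcov, hcl₁, hcl₂⟩ := hloc x hxK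
    obtain ⟨y, hyO, hyW⟩ := mem_closure_iff.1 hxW O hOo hxO
    have hyK : y ∉ K := by
      rw [hK, mem_compl_iff, not_not]
      exact Or.inr hyW
    refine ⟨O, hOo, hxO, ?_⟩
    rcases hcov hyO with h | h | h
    · exact absurd h hyK
    · exact hcl₁.trans (closure_mono (absorb hH₁ hH₁K h hyW))
    · exact hcl₂.trans (closure_mono (absorb hH₂ hH₂K h hyW))
  -- it is non-empty: otherwise `W` is clopen, non-empty and proper
  have hne : (K ∩ closure W).Nonempty := by
    by_contra h
    have hWc : IsClosed W := by
      refine closure_subset_iff_isClosed.1 fun y hy => ?_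
      have hyU : y ∉ U := (hUW.symm.closure_left hU).notMem_of_mem_left hy
      have hyK : y ∉ K := fun hyK => h ⟨y, hyK, hy⟩
      rw [hK, mem_compl_iff, not_not] at hyK
      exact hyK.resolve_left hyU
    have hWu : W = univ := IsClopen.eq_univ ⟨hWc, hW⟩ hWne
    obtain ⟨u, hu⟩ := hUne
    exact hUW.notMem_of_mem_left hu (hWu ▸ mem_univ u)
  -- conclude by preconnectedness of `K`
  choose! O hOo hxO hOW using hopen
  set u : Set X := ⋃ x ∈ K ∩ closure W, O x with hu
  have huo : IsOpen u := isOpen_biUnion fun x hx => hOo x hx.1 hx.2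
  have hKu : K ∩ u ⊆ closure W := by
    rintro y ⟨hyK, hyu⟩
    obtain ⟨x, hx, hyO⟩ := mem_iUnion₂.1 hyu
    exact hOW x hx.1 hx.2 ⟨hyK, hyO⟩
  have hKuv : K ⊆ u ∪ (closure W)ᶜ := by
    intro y hyK
    by_cases hy : y ∈ closure W
    · exact Or.inl (mem_biUnion (show y ∈ K ∩ closure W from ⟨hyK, hy⟩) (hxO y hyK hy))
    · exact Or.inr hy
  have hempty : K ∩ (u ∩ (closure W)ᶜ) = ∅ := by
    ext y
    simp only [mem_inter_iff, mem_compl_iff, mem_empty_iff_false, iff_false, not_and, not_not]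
    exact fun hyK hyu => hKu ⟨hyK, hyu⟩
  rcases (isPreconnected_iff_subset_of_disjoint.1 hKc) u (closure W)ᶜ huo
    isClosed_closure.isOpen_compl hKuv hempty with h | h
  · exact fun y hyK => hKu ⟨hyK, h hyK⟩
  · obtain ⟨q, hqK, hqW⟩ := hne
    exact absurd hqW (h hqK)

/-- **Frontier and regular-openness of a piece adherent along the splitting set.**  If `U, W`
are disjoint open sets with `K = (U ∪ W)ᶜ ⊆ closure U ∩ closure W`, then `frontier U = K` and
`interior (closure U) = U`: `closure U ⊆ U ∪ K` as `W` is open, and a point of `K` interior to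
`closure U ⊆ Wᶜ` could not be adherent to `W`. [folklore] -/
theorem frontier_eq_and_interior_closure_eq {U W K : Set X} (hU : IsOpen U) (hW : IsOpen W)
    (hUW : Disjoint U W) (hK : K = (U ∪ W)ᶜ) (hKU : K ⊆ closure U) (hKW : K ⊆ closure W) :
    frontier U = K ∧ interior (closure U) = U := by
  have hclW : Disjoint (closure U) W := hUW.closure_left hW
  have hcl : ∀ y ∈ closure U, y ∉ U → y ∈ K := fun y hy hyU => by
    rw [hK, mem_compl_iff]
    rintro (h | h)
    · exact hyU h
    · exact hclW.notMem_of_mem_left hy h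
  have hKU' : ∀ y ∈ K, y ∉ U := fun y hy hyU => by
    rw [hK] at hy
    exact hy (Or.inl hyU)
  refine ⟨?_, ?_⟩
  · rw [hU.frontier_eq]
    refine Subset.antisymm (fun y hy => hcl y hy.1 hy.2) fun y hy => ⟨hKU hy, hKU' y hy⟩
  · refine Subset.antisymm (fun y hy => ?_) (hU.subset_interior_iff.2 subset_closure)
    by_contra hyU
    have hyK : y ∈ K := hcl y (interior_subset hy) hyU
    obtain ⟨w, hwI, hwW⟩ := mem_closure_iff.1 (hKW hyK) _ isOpen_interior hy
    exact hclW.notMem_of_mem_left (interior_subset hwI) hwW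

end Splitting

/-! ### The stub -/

/-- **Stub 0 — the two sides of the fold.**  On a connected `4`-manifold `M`, let `V 0, V 1` be
disjoint non-empty open sets whose common complement is connected and is the image of a smooth
embedding `z : Z → M` of a `3`-manifold.  Then BOTH pieces have frontier exactly `Z = range z`,
and each is regular-open (`interior (closure (V i)) = V i`).  Proof: slice charts of the embedding
(`exists_local_sides`) give, at each point of `range z`, a box whose part off `range z` is covered
by two preconnected sets each adherent to every point of `range z` in the box; so the set of
points of `range z` adherent to `V 1` is open and closed in the connected `range z`, and
non-empty since otherwise `V 1` would be clopen, non-empty and proper in the connected `M`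
(`subset_closure_of_local_sides`); symmetrically for `V 0`; the two adherences give the frontier
and regular-openness (`frontier_eq_and_interior_closure_eq`). [folklore] -/
theorem stub_sides :
    ∀ (M : Type) [TopologicalSpace M] [T2Space M] [SecondCountableTopology M] [ConnectedSpace M]
      [ChartedSpace (𝔼 4) M] [IsManifold (𝓡 4) ∞ M]
      (V : Fin 2 → Opens M) (Z : Type) [TopologicalSpace Z] [ChartedSpace (𝔼 3) Z]
      [IsManifold (𝓡 3) ∞ Z] (z : Z → M),
      Disjoint (V 0) (V 1) → (∀ i, (V i : Set M).Nonempty) →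
      IsConnected ((V 0 : Set M) ∪ (V 1 : Set M))ᶜ →
      Manifold.IsSmoothEmbedding (𝓡 3) (𝓡 4) ∞ z →
      Set.range z = ((V 0 : Set M) ∪ (V 1 : Set M))ᶜ →
      ∀ i, frontier (V i : Set M) = Set.range z ∧
        interior (closure (V i : Set M)) = (V i : Set M) := by
  intro M _ _ _ _ _ _ V Z _ _ _ z hdisj hne hconn hz hrange i
  have hd : Disjoint (V 0 : Set M) (V 1) := Opens.coe_disjoint.2 hdisj
  have hKc : IsPreconnected (Set.range z) := by
    rw [hrange]
    exact hconn.isPreconnected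
  have hloc : ∀ x ∈ Set.range z, ∃ O H₁ H₂ : Set M, IsOpen O ∧ x ∈ O ∧ IsPreconnected H₁ ∧
      IsPreconnected H₂ ∧ H₁ ⊆ (Set.range z)ᶜ ∧ H₂ ⊆ (Set.range z)ᶜ ∧
      O ⊆ Set.range z ∪ (H₁ ∪ H₂) ∧
      Set.range z ∩ O ⊆ closure H₁ ∧ Set.range z ∩ O ⊆ closure H₂ := by
    rintro _ ⟨p, rfl⟩
    exact exists_local_sides hz p
  have h1 : Set.range z ⊆ closure (V 1 : Set M) :=
    subset_closure_of_local_sides (V 0).isOpen (V 1).isOpen hd (hne 0) (hne 1) hrange hKc hloc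
  have h0 : Set.range z ⊆ closure (V 0 : Set M) :=
    subset_closure_of_local_sides (V 1).isOpen (V 0).isOpen hd.symm (hne 1) (hne 0)
      (hrange.trans (by rw [union_comm])) hKc hloc
  have hi : i = 0 ∨ i = 1 := by fin_cases i <;> simp
  rcases hi with rfl | rfl
  · obtain ⟨hf, hr⟩ := frontier_eq_and_interior_closure_eq (V 0).isOpen (V 1).isOpen hd hrange h0 h1
    exact ⟨hf, hr⟩
  · obtain ⟨hf, hr⟩ := frontier_eq_and_interior_closure_eq (V 1).isOpen (V 0).isOpen hd.symm
      (hrange.trans (by rw [union_comm])) h1 h0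
    exact ⟨hf, hr⟩

end Summit.SmoothPoincare4.SmoothPoincare4.Theorems.OrigamiRung.PairRigidityEndgame

end
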